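import Literature.AlgebraicGeometry.Motives.UniversalHyperplaneSectionSmoothProjective
import Literature.AlgebraicGeometry.HodgeTheory.HyperplaneSectionMonodromySmoothLocus
import Literature.AlgebraicGeometry.Motives.HypersurfaceFieldPoints
import Literature.NumberTheory.Transcendental.Analytification
import HarnessLib

/-!
# The family of hyperplane sections of the fibres of a smooth projective family, I: players

Topic `Literature/AlgebraicGeometry/Motives` (theorems only; no definitions, no named facts).
Thomas's hyperplane descent `VHC(n+1, p) ⇐ VHC(n, p)` for the variational Hodge conjecture
(Thomas 2005 §5; Voisin, *Hodge Theory II* §1.2, §3.2.2) transports algebraicity along the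
**family of hyperplane sections of the fibres** of a smooth projective family `f : 𝒳 ⟶ S`: for an
affine `e : 𝒳 ⟶ ℙᴺ` (e.g. a closed `S`-immersion `𝒳 ↪ ℙᴺ × S` followed by the projection, `S`
affine), the universal hyperplane section `𝒴 = {(x, H) | e(x) ∈ H} ⊆ 𝒳 × (ℙᴺ)^*` of the TOTAL space
(`Motives.universalHyperplaneSection N e`) with the morphism
`g = (toX ≫ f, proj) : 𝒴 ⟶ S × (ℙᴺ)^*` (written out as
`CartesianMonoidalCategory.lift (toX N e ≫ f) (proj N e)` throughout; no new definition is
introduced), whose fibre over `(t, H)` is the hyperplane section `X_t ∩ H`. This first file collects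
the players (namespace `Motives.SectionFamily`): instances on `S × (ℙᴺ)^*`, `𝒳`, `𝒴`; properness and
finite presentation of `g`; and the comparison, at a complex point `b` of a separated `ℂ`-scheme `B`,
between the fibre `fiberOver g b` (over `Spec ℂ`) and Mathlib's scheme-theoretic fibre `g.fiber b.pt`
(over `Spec κ(b.pt)`): the closed immersions `Spec ℂ ⟶ B` and `Spec κ(b.pt) ⟶ B` are isomorphic over
`B` (`exists_iso_fromSpecResidueField`), so smoothness passes from one fibre to the other
(`smooth_fiberToSpecResidueField_of_fiberOver`). Sequel: `UniversalHyperplaneSectionFamilyGoodLocus`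
(the good locus over which `g` is smooth).

## References

* [Thomas2005Nodes] R. P. Thomas, Nodes and the Hodge conjecture, J. Algebraic Geom. 14 (2005), §5.
* [VoisinHodgeII2003] C. Voisin, Hodge Theory and Complex Algebraic Geometry II, CUP 2003, §3.2.2.
-/

noncomputable section

open CategoryTheory CategoryTheory.Limits AlgebraicGeometry TopologicalSpace MonoidalCategory
  CartesianMonoidalCategory
open Literature.AlgebraicGeometry.HodgeTheory
open Literature.AlgebraicGeometry.Motives.UniversalHyperplaneSection

universe u

namespace Literature.AlgebraicGeometry.Motives.SectionFamily

/-! ### The base `S × (ℙᴺ)^*` -/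

section Base

variable (S P : SchemeOver ℂ)

/-- For `S` affine, the projection `P × S ⟶ P` is an affine morphism (base change of the affine
structure map `S ⟶ Spec ℂ`). [folklore] -/
theorem isAffineHom_fst_left [IsAffine S.left] : IsAffineHom (fst P S).left := by
  have h : IsAffineHom (pullback.fst P.hom S.hom) :=
    MorphismProperty.pullback_fst (P := @IsAffineHom) _ _ inferInstance
  exact h

/-- `S × P ⟶ Spec ℂ` is smooth of relative dimension `m + d` when `S`, `P` are smooth of relative
dimensions `d`, `m`. [folklore] -/
theorem smoothOfRelativeDimension_tensorObj_hom {d m : ℕ} [SmoothOfRelativeDimension d S.hom]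
    [SmoothOfRelativeDimension m P.hom] : SmoothOfRelativeDimension (m + d) (S ⊗ P).hom := by
  haveI := smoothOfRelativeDimension_isStableUnderBaseChange (n := m)
  have h1 : SmoothOfRelativeDimension m (pullback.fst S.hom P.hom) :=
    MorphismProperty.pullback_fst (P := @SmoothOfRelativeDimension m) _ _ inferInstance
  have h2 : SmoothOfRelativeDimension (m + d) (pullback.fst S.hom P.hom ≫ S.hom) := inferInstance
  exact h2

/-- `S × P ⟶ Spec ℂ` is separated when `S`, `P` are. [folklore] -/
theorem isSeparated_tensorObj_hom [IsSeparated S.hom] [IsSeparated P.hom] : IsSeparated (S ⊗ P).hom := by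
  have h1 : IsSeparated (pullback.fst S.hom P.hom) := inferInstance
  have h2 : IsSeparated (pullback.fst S.hom P.hom ≫ S.hom) := inferInstance
  exact h2

/-- `S × P` is quasi-compact when `S` is and `P ⟶ Spec ℂ` is quasi-compact. [folklore] -/
theorem compactSpace_tensorObj_left [CompactSpace S.left] [QuasiCompact P.hom] :
    CompactSpace (S ⊗ P).left := by
  have h1 : QuasiCompact (pullback.fst S.hom P.hom) :=
    MorphismProperty.pullback_fst (P := @QuasiCompact) _ _ inferInstance
  exact @QuasiCompact.compactSpace_of_compactSpace _ _ (pullback.fst S.hom P.hom) h1 _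

/-- `S × P ⟶ Spec ℂ` is locally of finite type when `S`, `P` are. [folklore] -/
theorem locallyOfFiniteType_tensorObj_hom [LocallyOfFiniteType S.hom] [LocallyOfFiniteType P.hom] :
    LocallyOfFiniteType (S ⊗ P).hom := by
  have h1 : LocallyOfFiniteType (pullback.fst S.hom P.hom) := inferInstance
  have h2 : LocallyOfFiniteType (pullback.fst S.hom P.hom ≫ S.hom) := inferInstance
  exact h2

/-- `S × P ⟶ Spec ℂ` is smooth when `S`, `P` are. [folklore] -/
theorem smooth_tensorObj_hom [Smooth S.hom] [Smooth P.hom] : Smooth (S ⊗ P).hom := by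
  have h1 : Smooth (pullback.fst S.hom P.hom) := inferInstance
  have h2 : Smooth (pullback.fst S.hom P.hom ≫ S.hom) := inferInstance
  exact h2

/-- The projection `S × P ⟶ S` is proper when `P ⟶ Spec ℂ` is. [folklore] -/
theorem isProper_fst_left [IsProper P.hom] : IsProper (fst S P).left := by
  have h : IsProper (pullback.fst S.hom P.hom) := inferInstance
  exact h

/-- The projection `S × P ⟶ S` is separated when `P ⟶ Spec ℂ` is. [folklore] -/
theorem isSeparated_fst_left [IsSeparated P.hom] : IsSeparated (fst S P).left := by
  have h : IsSeparated (pullback.fst S.hom P.hom) := inferInstance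
  exact h

end Base

/-! ### Instances on the players -/

section Players

variable {n N : ℕ} {𝒳 S : SchemeOver ℂ} (f : 𝒳 ⟶ S) (e : 𝒳 ⟶ projectiveSpace N ℂ)

/-- The dual projective space is smooth of relative dimension `N`, proper, separated. [folklore] -/
theorem smoothOfRelativeDimension_dualProjectiveSpace_hom :
    SmoothOfRelativeDimension N (dualProjectiveSpace N ℂ).hom :=
  (isSmoothProjective_projectiveSpace_holds ℂ N).smoothOfRelativeDimension

/-- `(ℙᴺ)^* ⟶ Spec ℂ` is proper. [folklore] -/
theorem isProper_dualProjectiveSpace_hom : IsProper (dualProjectiveSpace N ℂ).hom :=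
  IsSmoothProjective.isProper_holds (isSmoothProjective_projectiveSpace_holds ℂ N)

/-- The total space of a smooth projective family over a smooth base is smooth over `ℂ`, of
relative dimension `n + d`. [folklore] -/
theorem smoothOfRelativeDimension_total_hom {d : ℕ} (hf : IsSmoothProjectiveFamily f n)
    [SmoothOfRelativeDimension d S.hom] : SmoothOfRelativeDimension (n + d) 𝒳.hom := by
  haveI := hf.smoothOfRelativeDimension
  have h : SmoothOfRelativeDimension (n + d) (f.left ≫ S.hom) := inferInstance
  rwa [Over.w f] at h

/-- The total space of a proper family over an affine (quasi-compact) base is quasi-compact. [folklore] -/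
theorem compactSpace_total_left (hf : IsSmoothProjectiveFamily f n) [CompactSpace S.left] :
    CompactSpace 𝒳.left := by
  haveI := hf.isProper
  exact QuasiCompact.compactSpace_of_compactSpace f.left

/-- The total space of a proper family over a separated base is separated over `ℂ`. [folklore] -/
theorem isSeparated_total_hom (hf : IsSmoothProjectiveFamily f n) [IsSeparated S.hom] :
    IsSeparated 𝒳.hom := by
  haveI := hf.isProper
  have h : IsSeparated (f.left ≫ S.hom) := inferInstance
  rwa [Over.w f] at h

/-- The total space is locally of finite type over `ℂ`. [folklore] -/
theorem locallyOfFiniteType_total_hom (hf : IsSmoothProjectiveFamily f n) [LocallyOfFiniteType S.hom] :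
    LocallyOfFiniteType 𝒳.hom := by
  haveI := hf.isProper
  have h : LocallyOfFiniteType (f.left ≫ S.hom) := inferInstance
  rwa [Over.w f] at h

-- `𝒴` is separated over `ℂ` when `𝒳` is: `HodgeTheory.isSeparated_universalHyperplaneSection_hom N e`
-- (file `HodgeTheory/HyperplaneSectionMonodromyTrivialisations`).

/-- `𝒴` is locally of finite type over `ℂ`. [folklore] -/
theorem locallyOfFiniteType_section_hom [LocallyOfFiniteType 𝒳.hom] :
    LocallyOfFiniteType (universalHyperplaneSection N e).hom := by
  have h : (universalHyperplaneSection N e).hom = (emb N e).left ≫ (𝒳 ⊗ dualProjectiveSpace N ℂ).hom :=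
    (Over.w (emb N e)).symm
  rw [h]
  haveI : LocallyOfFiniteType (dualProjectiveSpace N ℂ).hom := inferInstance
  haveI := locallyOfFiniteType_tensorObj_hom 𝒳 (dualProjectiveSpace N ℂ)
  infer_instance

/-- `𝒴` is quasi-compact when `𝒳` is. [folklore] -/
theorem compactSpace_section_left [CompactSpace 𝒳.left] :
    CompactSpace (universalHyperplaneSection N e).left := by
  haveI : QuasiCompact (dualProjectiveSpace N ℂ).hom := inferInstance
  haveI := compactSpace_tensorObj_left 𝒳 (dualProjectiveSpace N ℂ)
  exact QuasiCompact.compactSpace_of_compactSpace (emb N e).left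

/-- `toX : 𝒴 ⟶ 𝒳` is proper (a closed immersion followed by the base change of `(ℙᴺ)^* → Spec ℂ`).
[folklore] -/
theorem isProper_toX_left : IsProper (toX N e).left := by
  change IsProper ((emb N e).left ≫ (fst 𝒳 (dualProjectiveSpace N ℂ)).left)
  haveI := isProper_fst_left 𝒳 (dualProjectiveSpace N ℂ)
  infer_instance

/-- **The family of hyperplane sections of the fibres** `g = (toX ≫ f, proj) : 𝒴 ⟶ S × (ℙᴺ)^*`
composed with the first projection is `toX ≫ f`. [folklore] -/
theorem sectionFamily_fst :
    CartesianMonoidalCategory.lift (toX N e ≫ f) (proj N e) ≫ fst S (dualProjectiveSpace N ℂ) = toX N e ≫ f :=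
  lift_fst _ _

/-- `g ≫ pr₂ = proj`. [folklore] -/
theorem sectionFamily_snd :
    CartesianMonoidalCategory.lift (toX N e ≫ f) (proj N e) ≫ snd S (dualProjectiveSpace N ℂ) = proj N e :=
  lift_snd _ _

/-- `g` is proper (its composite with the separated `pr₁ : S × (ℙᴺ)^* ⟶ S` is the proper `toX ≫ f`).
[folklore] -/
theorem isProper_sectionFamily_left (hf : IsSmoothProjectiveFamily f n) :
    IsProper (CartesianMonoidalCategory.lift (toX N e ≫ f) (proj N e)).left := by
  haveI := hf.isProper
  haveI := isProper_toX_left e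
  haveI := isSeparated_fst_left S (dualProjectiveSpace N ℂ)
  haveI : IsProper ((CartesianMonoidalCategory.lift (toX N e ≫ f) (proj N e)).left ≫
      (fst S (dualProjectiveSpace N ℂ)).left) := by
    rw [← Over.comp_left, sectionFamily_fst, Over.comp_left]
    infer_instance
  exact IsProper.of_comp _ (fst S (dualProjectiveSpace N ℂ)).left

/-- `g` is locally of finite type. [folklore] -/
theorem locallyOfFiniteType_sectionFamily_left [LocallyOfFiniteType 𝒳.hom] [LocallyOfFiniteType S.hom] :
    LocallyOfFiniteType (CartesianMonoidalCategory.lift (toX N e ≫ f) (proj N e)).left := by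
  haveI := locallyOfFiniteType_section_hom e
  haveI : LocallyOfFiniteType (dualProjectiveSpace N ℂ).hom := inferInstance
  haveI := locallyOfFiniteType_tensorObj_hom S (dualProjectiveSpace N ℂ)
  have h : LocallyOfFiniteType ((CartesianMonoidalCategory.lift (toX N e ≫ f) (proj N e)).left ≫
      (S ⊗ dualProjectiveSpace N ℂ).hom) := by
    rw [Over.w]; infer_instance
  exact locallyOfFiniteType_of_comp _ (S ⊗ dualProjectiveSpace N ℂ).hom

/-- `g` is locally of finite presentation (source and target are locally Noetherian). [folklore] -/
theorem locallyOfFinitePresentation_sectionFamily_left [LocallyOfFiniteType 𝒳.hom]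
    [LocallyOfFiniteType S.hom] :
    LocallyOfFinitePresentation (CartesianMonoidalCategory.lift (toX N e ≫ f) (proj N e)).left := by
  haveI := locallyOfFiniteType_sectionFamily_left f e
  haveI : LocallyOfFiniteType (dualProjectiveSpace N ℂ).hom := inferInstance
  haveI := locallyOfFiniteType_tensorObj_hom S (dualProjectiveSpace N ℂ)
  haveI : IsLocallyNoetherian (S ⊗ dualProjectiveSpace N ℂ).left :=
    LocallyOfFiniteType.isLocallyNoetherian (S ⊗ dualProjectiveSpace N ℂ).hom
  -- adapted from `HodgeTheory.locallyOfFinitePresentation_of_isLocallyNoetherian` (AlgebraicityLocusCurves)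
  rw [HasRingHomProperty.iff_appLE (P := @LocallyOfFinitePresentation)]
  intro U V e'
  haveI := IsLocallyNoetherian.component_noetherian (X := (S ⊗ dualProjectiveSpace N ℂ).left) U
  exact RingHom.FinitePresentation.of_finiteType.mp
    (HasRingHomProperty.appLE @LocallyOfFiniteType _ inferInstance U V e')

end Players


/-! ### Rational points: the scheme-theoretic fibre over `b.pt` versus the fibre over `b` -/

section RationalFibre

variable {Y B : SchemeOver ℂ} (g : Y ⟶ B) (b : ComplexPoints B)

/-- For a complex point `b` of a separated `B` locally of finite type over `ℂ`, the closed point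
`Spec ℂ ⟶ B` and `Spec κ(b) ⟶ B` are isomorphic over `B` (both are reduced closed immersions with
image `{b}`). [folklore] -/
theorem exists_iso_fromSpecResidueField [IsSeparated B.hom] :
    ∃ φ : (specOver ℂ ℂ).left ≅ Spec (B.left.residueField b.pt),
      φ.hom ≫ B.left.fromSpecResidueField b.pt = b.left := by
  haveI : IsClosedImmersion b.left := isClosedImmersion_left_of_algPoints b
  haveI : Subsingleton (specOver ℂ ℂ).left := inferInstanceAs (Subsingleton (PrimeSpectrum ℂ))
  haveI : IsReduced (specOver ℂ ℂ).left := inferInstanceAs (IsReduced (Spec (.of ℂ)))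
  haveI : IsClosedImmersion (B.left.fromSpecResidueField b.pt) :=
    isClosed_singleton_iff_isClosedImmersion.mp (ComplexPoints.isClosed_pt b)
  have hr₁ : Set.range b.left.base = {b.pt} := by
    ext x
    simp only [Set.mem_range, Set.mem_singleton_iff]
    constructor
    · rintro ⟨y, rfl⟩
      rw [Subsingleton.elim y (IsLocalRing.closedPoint ℂ)]
      rfl
    · rintro rfl
      exact ⟨IsLocalRing.closedPoint ℂ, rfl⟩
  have hr₂ : Set.range (B.left.fromSpecResidueField b.pt).base = {b.pt} :=
    Scheme.range_fromSpecResidueField b.pt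
  have h12 : Set.range b.left.base ⊆ Set.range (B.left.fromSpecResidueField b.pt).base := by
    rw [hr₁, hr₂]
  have h21 : Set.range (B.left.fromSpecResidueField b.pt).base ⊆ Set.range b.left.base := by
    rw [hr₁, hr₂]
  refine ⟨⟨liftOfRangeSubset _ _ h12, liftOfRangeSubset _ _ h21, ?_, ?_⟩, liftOfRangeSubset_comp _ _ h12⟩
  · rw [← cancel_mono b.left, Category.assoc, liftOfRangeSubset_comp, liftOfRangeSubset_comp,
      Category.id_comp]
  · rw [← cancel_mono (B.left.fromSpecResidueField b.pt), Category.assoc, liftOfRangeSubset_comp,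
      liftOfRangeSubset_comp, Category.id_comp]

/-- **The fibre of `g` over `b ∈ B(ℂ)` and Mathlib's scheme-theoretic fibre over the point `b.pt`
have isomorphic structure maps**: a property of morphisms respecting isomorphisms and stable under
base change holds for `g⁻¹(b.pt) ⟶ Spec κ(b.pt)` iff it holds for `Y_b ⟶ Spec ℂ`. [folklore] -/
theorem fiberToSpecResidueField_iff [IsSeparated B.hom] (P : MorphismProperty Scheme.{0}) [P.RespectsIso]
    [P.IsStableUnderBaseChange] :
    P (g.left.fiberToSpecResidueField b.pt) ↔ P (pullback.snd g.left b.left) := by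
  obtain ⟨φ, hφ⟩ := exists_iso_fromSpecResidueField b
  have H1 : IsPullback (pullback.fst g.left b.left) (pullback.snd g.left b.left) g.left
      (φ.hom ≫ B.left.fromSpecResidueField b.pt) := by
    rw [hφ]; exact IsPullback.of_hasPullback _ _
  have H2 : IsPullback (g.left.fiberι b.pt) (g.left.fiberToSpecResidueField b.pt) g.left
      (B.left.fromSpecResidueField b.pt) := IsPullback.of_hasPullback _ _
  -- `Y_b ⟶ Spec ℂ` is the base change of the fibre along the isomorphism `φ`
  have Q := IsPullback.of_right' H1 H2
  constructor
  · intro h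
    exact P.of_isPullback Q h
  · intro h
    haveI := Q.isIso_fst_of_isIso (inferInstance : IsIso φ.hom)
    have hw' := (IsIso.eq_inv_comp _).mpr Q.w
    rw [hw']
    exact (P.cancel_left_of_respectsIso _ _).mpr ((P.cancel_right_of_respectsIso _ φ.hom).mpr h)

/-- The fibre `Y_b ⟶ Spec ℂ` is smooth (of relative dimension `n`) iff the structure map of the
`ℂ`-scheme `fiberOver g b` is. [folklore] -/
theorem snd_iff_fiberOver_hom (P : MorphismProperty Scheme.{0}) [P.RespectsIso] :
    P (pullback.snd g.left b.left) ↔ P (fiberOver g b).hom := by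
  haveI := isIso_specOver_self_hom (k := ℂ)
  rw [fiberOver_hom]
  exact (P.cancel_right_of_respectsIso (pullback.snd g.left b.left) (specOver ℂ ℂ).hom).symm

/-- **Smoothness of the scheme-theoretic fibre from smoothness of the `ℂ`-scheme `Y_b`.** [folklore] -/
theorem smooth_fiberToSpecResidueField_of_fiberOver [IsSeparated B.hom] {n : ℕ}
    (h : SmoothOfRelativeDimension n (fiberOver g b).hom) :
    Smooth (g.left.fiberToSpecResidueField b.pt) ∧
      SmoothOfRelativeDimension n (g.left.fiberToSpecResidueField b.pt) := by
  haveI := smoothOfRelativeDimension_isStableUnderBaseChange (n := n)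
  have h1 : SmoothOfRelativeDimension n (g.left.fiberToSpecResidueField b.pt) := by
    rw [fiberToSpecResidueField_iff g b (@SmoothOfRelativeDimension n),
      snd_iff_fiberOver_hom g b (@SmoothOfRelativeDimension n)]
    exact h
  exact ⟨SmoothOfRelativeDimension.smooth n _, h1⟩

end RationalFibre

end Literature.AlgebraicGeometry.Motives.SectionFamily

end
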